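import Summits.BirchSwinnertonDyer.Rank1Residual.X4.KuriharaAdditiveCertificateOfCycles
import Summits.BirchSwinnertonDyer.Rank1Residual.X4.TwoPrimeExactnessBridgesOnCycles
import HarnessLib

/-!
# THE ADDITIVE CERTIFICATE FROM THE CALEGARI–VENKATESH COMPLEX ON CYCLES: `f = f_E`, modulus `p^e`, from the FREE decomposition on `H₁(X₀(N), ℤ)`, FULL two-prime exactness of the level-raising complex on cycles (the `i = 2` case of CV's Conjecture 4.1 at `𝔫`), and Ihara's lemma BY NAME (cell `b2b-bsdres`, seat additive-p4 gen 33, line V56 — K102 = K97 ∘ K101)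

HONEST FRAMING (verbatim, cell `b2b-bsdres`): the goal of the cell is to DELETE the COMBINATION-SHAPED
residual classes for ALL analytic-rank `≤ 1` curves over `ℚ` — "full BSD formula for every rank `≤ 1`
curve in class `C`" assembled STRICTLY from published theorems — so that the rank-`≤ 1` remainder
becomes exactly the CONSTRUCTION-SHAPED classes, which are TYPED (missing-input Props), NOT attempted;
this is not "finishing BSD". This file: ONE research-route KERNEL THEOREM (assembly; Ihara's lemma
enters BY NAME as `hI : ribet1984_iharaLemma`; no conjecture asserted — the Calegari–Venkatesh
exactness enters as a HYPOTHESIS `hfullC`; nothing booked; X4 stays CONSTRUCTION-SHAPED; 0 defs).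

## What is proved

`plusSymbolLevelLowersAdditivelyModAt_of_fullCycles_of_ribet1984_iharaLemma`: the data of
`X4/KuriharaAdditiveCertificateOfCycles.plusSymbolLevelLowersAdditivelyModAt_of_cycles_of_ribet1984_iharaLemma`
(K97) with its SIGNED cycle-exactness hypothesis `hexactC` REPLACED by
(i) `hfullC` — middle exactness ON CYCLES of the FULL two-prime old-space complex
`𝓛₀⁴ → 𝓛₁² ⊕ 𝓛₂² → Hom(H₁(X₀(N)), ℤ/p^e)` (both degeneracy copies at each prime: the row `E¹_{•,1}` of the
spectral sequence of `Γ₀(M₀; ℤ[1/ℓ₁ℓ₂])` on the product of two trees — Calegari–Venkatesh, Astérisque 409,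
Ch. 4 Thm 35; its exactness at a non-Eisenstein maximal ideal is the `i = 2` case of their Conjecture 4.1,
OPEN in print; EVIDENCE: census E12 of gen 33, 0 refuting instances at all levels `≤ 2000`);
(ii) `hsmul₀` (scalar stability of `𝓛₀`); (iii) `hinjC₂` — two-copy injectivity at `ℓ₁` from `M₀` to
`M₂` on `𝓛₀` (Ihara at `ℓ₁`, dual form; dischargeable by `twoCopy_apply_eq_zero_of_ribet1984_iharaLemma`
when `M₂ = M₀ℓ₁` and `𝓛₀` is supported at a non-Eisenstein maximal ideal of `𝕋̃(M₀; M₀ℓ₁)`).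
The two-copy injectivity at `ℓ₂` (`M₀ → M₀ℓ₂`) is DISCHARGED here from `ribet1984_iharaLemma` via the
`𝔫`-support of `𝓛₀` that K97 already carries. Proof = K97 ∘ `signedExactCycles_of_fullExactCycles` (K101).

## References

* F. Calegari, A. Venkatesh, Astérisque 409 (2019), Ch. 4 Thm 35, Conj. 4.1. [cite: CalegariVenkatesh2019, Ch. 4, Conj. 4.1]
* K. A. Ribet, Proc. ICM 1983 (1984), Thm. 4.1 — BY NAME. [cite: Ribet1984ICM, Thm. 4.1]
* B. Mazur, J. Tate, J. Teitelbaum, Invent. Math. 84 (1986), §I.4 (4.2), §I.8. [cite: MazurTateTeitelbaum1986Invent, §I.4 (4.2) and §I.8]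
* C.-H. Kim, Amer. J. Math. 148 (2026), §1.4.3, §1.5.1. [cite: Kim2022StructureSelmer, §1.4.3 and §1.5.1 (PDF p. 7)]
-/

noncomputable section

open scoped MatrixGroups ModularForm

open CongruenceSubgroup Finset Matrix

open Literature.NumberTheory.EllipticCurves Literature.NumberTheory.EllipticCurves.ModularForms
  Literature.NumberTheory.EllipticCurves.ModularForms.HidaCohomology

open Literature.NumberTheory.DiophantineGeometry.Dioph (ratModP)

namespace Summit.BirchSwinnertonDyer.Rank1Residual.LevelLowering

section OfFullCycles

variable {W : WeierstrassCurve ℚ} [W.IsElliptic] [W.IsGloballyMinimal] {p : ℕ} [hp : Fact p.Prime]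

/-- **THE ADDITIVE CERTIFICATE OF `f_E` FROM THE FULL (CALEGARI–VENKATESH) COMPLEX ON CYCLES AND
IHARA'S LEMMA** (see the module docstring): K97's data with `hexactC` replaced by FULL cycle-exactness
`hfullC`, scalar stability `hsmul₀`, and the two-copy injectivity `hinjC₂` at `ℓ₁`; the one at `ℓ₂` is
discharged from `ribet1984_iharaLemma`. [cite: CalegariVenkatesh2019, Ch. 4, Conj. 4.1] [cite: Ribet1984ICM, Thm. 4.1]
[cite: Kim2022StructureSelmer, §1.4.3 and §1.5.1 (PDF p. 7)] -/
theorem plusSymbolLevelLowersAdditivelyModAt_of_fullCycles_of_ribet1984_iharaLemma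
    (hI : ribet1984_iharaLemma) (hp2 : p ≠ 2) (hirr : W.HasIrreducibleModPGaloisRep p)
    {N : ℕ} [NeZero N] {f : CuspForm (Gamma0 N) 2} (hf : IsNewformOf W f)
    (hN : W.conductorNorm ℤ = N) {e ℓ₁ ℓ₂ M₀ M₂ : ℕ} [NeZero M₀] [NeZero M₂] [NeZero ℓ₁]
    [Fact ℓ₂.Prime] (hℓ₁N : ℓ₁ ∣ N) (hℓ₂N : ℓ₂ ∣ N) (hℓ₂M₀ : ¬ ℓ₂ ∣ M₀)
    (h02 : M₀ * 1 ∣ M₂) (h02' : M₀ * ℓ₁ ∣ M₂)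
    (h1N : M₀ * ℓ₂ * 1 ∣ N) (h1N' : M₀ * ℓ₂ * ℓ₁ ∣ N) (h2N : M₂ * 1 ∣ N) (h2N' : M₂ * ℓ₂ ∣ N)
    (σ0 : ℚ → Module.Dual ℂ (CuspForm (Gamma0 M₀) 2))
    (hσ0 : ∀ (r : ℚ) (g : CuspForm (Gamma0 M₀) 2), σ0 r g = modularSymbol g r)
    (σ1 : ℚ → Module.Dual ℂ (CuspForm (Gamma0 (M₀ * ℓ₂)) 2))
    (hσ1 : ∀ (r : ℚ) (g : CuspForm (Gamma0 (M₀ * ℓ₂)) 2), σ1 r g = modularSymbol g r)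
    (σ2 : ℚ → Module.Dual ℂ (CuspForm (Gamma0 M₂) 2))
    (hσ2 : ∀ (r : ℚ) (g : CuspForm (Gamma0 M₂) 2), σ2 r g = modularSymbol g r)
    (σN : ℚ → Module.Dual ℂ (CuspForm (Gamma0 N) 2))
    (hσN : ∀ (r : ℚ) (g : CuspForm (Gamma0 N) 2), σN r g = modularSymbol g r)
    {q₀ : ℕ} (hq₀ : q₀.Prime) (hq₀1 : q₀ ≡ 1 [MOD N]) (hq₀N : ¬ q₀ ∣ N)
    {u : ZMod (p ^ e)} (hu : (((W.frobeniusTrace q₀ : ℤ) : ZMod (p ^ e)) - ((q₀ + 1 : ℕ) : ZMod (p ^ e))) * u = 1)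
    (𝔫 : Ideal (HeckeRing0.primeTo M₀ 2 (M₀ * ℓ₂))) (h𝔫 : 𝔫.IsMaximal)
    (h2𝔫 : (2 : HeckeRing0.primeTo M₀ 2 (M₀ * ℓ₂)) ∉ 𝔫) (hq₀S : ¬ q₀ ∣ M₀ * ℓ₂)
    (hq₀E : HeckeRing0.primeTo.T M₀ 2 (M₀ * ℓ₂) hq₀ hq₀S -
      ((q₀ : HeckeRing0.primeTo M₀ 2 (M₀ * ℓ₂)) + 1) ∉ 𝔫)
    (𝓛₁ : Set (Module.Dual ℂ (CuspForm (Gamma0 (M₀ * ℓ₂)) 2) → ZMod (p ^ e)))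
    (𝓛₂ : Set (Module.Dual ℂ (CuspForm (Gamma0 M₂) 2) → ZMod (p ^ e)))
    (𝓛₀ : Set (Module.Dual ℂ (CuspForm (Gamma0 M₀) 2) → ZMod (p ^ e)))
    -- additivity
    (hadd₁ : ∀ Λ ∈ 𝓛₁, ∀ x ∈ periodHomology (M₀ * ℓ₂), ∀ y ∈ periodHomology (M₀ * ℓ₂), Λ (x + y) = Λ x + Λ y)
    (hadd₂ : ∀ Λ ∈ 𝓛₂, ∀ x ∈ periodHomology M₂, ∀ y ∈ periodHomology M₂, Λ (x + y) = Λ x + Λ y)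
    (hadd₀ : ∀ Λ ∈ 𝓛₀, ∀ x ∈ periodHomology M₀, ∀ y ∈ periodHomology M₀, Λ (x + y) = Λ x + Λ y)
    -- Hecke stability (`Λ ↦ Λ(T_q •) − a_q(E) Λ`, `q ∤` level)
    (hT₁ : ∀ Λ ∈ 𝓛₁, ∀ (q : ℕ) (hq : q.Prime), ¬ q ∣ M₀ * ℓ₂ →
      (fun z ↦ Λ (HeckeRing0.T (M₀ * ℓ₂) 2 q hq • z) - (W.frobeniusTrace q : ZMod (p ^ e)) * Λ z) ∈ 𝓛₁)
    (hT₂ : ∀ Λ ∈ 𝓛₂, ∀ (q : ℕ) (hq : q.Prime), ¬ q ∣ M₂ →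
      (fun z ↦ Λ (HeckeRing0.T M₂ 2 q hq • z) - (W.frobeniusTrace q : ZMod (p ^ e)) * Λ z) ∈ 𝓛₂)
    (hT₀ : ∀ Λ ∈ 𝓛₀, ∀ (q : ℕ) (hq : q.Prime), ¬ q ∣ M₀ →
      (fun z ↦ Λ (HeckeRing0.T M₀ 2 q hq • z) - (W.frobeniusTrace q : ZMod (p ^ e)) * Λ z) ∈ 𝓛₀)
    -- stability under the closing operator, differences, scalars
    (hA₁ : ∀ Λ ∈ 𝓛₁, (fun x ↦ Λ (HeckeRing0.T (M₀ * ℓ₂) 2 q₀ hq₀ • x - ((q₀ + 1 : ℕ) : ℂ) • x)) ∈ 𝓛₁)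
    (hA₂ : ∀ Λ ∈ 𝓛₂, (fun x ↦ Λ (HeckeRing0.T M₂ 2 q₀ hq₀ • x - ((q₀ + 1 : ℕ) : ℂ) • x)) ∈ 𝓛₂)
    (hsub₁ : ∀ Λ ∈ 𝓛₁, ∀ Λ' ∈ 𝓛₁, (fun x ↦ Λ x - Λ' x) ∈ 𝓛₁)
    (hsub₂ : ∀ Λ ∈ 𝓛₂, ∀ Λ' ∈ 𝓛₂, (fun x ↦ Λ x - Λ' x) ∈ 𝓛₂)
    (hsub₀ : ∀ Λ ∈ 𝓛₀, ∀ Λ' ∈ 𝓛₀, (fun x ↦ Λ x - Λ' x) ∈ 𝓛₀)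
    (hsmul₁ : ∀ Λ ∈ 𝓛₁, ∀ c : ZMod (p ^ e), (fun x ↦ c * Λ x) ∈ 𝓛₁)
    (hsmul₂ : ∀ Λ ∈ 𝓛₂, ∀ c : ZMod (p ^ e), (fun x ↦ c * Λ x) ∈ 𝓛₂)
    -- pull-backs
    (hpull₁ : ∀ Λ₀ ∈ 𝓛₀, (fun x ↦ Λ₀ ((degeneracyMap0 M₀ (M₀ * ℓ₂) 1 2).dualMap x) -
      1 * Λ₀ ((degeneracyMap0 M₀ (M₀ * ℓ₂) ℓ₂ 2).dualMap x)) ∈ 𝓛₁)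
    (hpull₂ : ∀ Λ₀ ∈ 𝓛₀, (fun x ↦ -(Λ₀ ((degeneracyMap0 M₀ M₂ 1 2).dualMap x) -
      1 * Λ₀ ((degeneracyMap0 M₀ M₂ ℓ₁ 2).dualMap x))) ∈ 𝓛₂)
    -- support on the closing operator / at `𝔫`, surjectivity of the closing operator on `𝓛₀`
    (hsupp₁ : ∀ Λ ∈ 𝓛₁, (∀ x ∈ periodHomology (M₀ * ℓ₂),
      Λ (HeckeRing0.T (M₀ * ℓ₂) 2 q₀ hq₀ • x - ((q₀ + 1 : ℕ) : ℂ) • x) = 0) →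
      ∀ x ∈ periodHomology (M₀ * ℓ₂), Λ x = 0)
    (hsupp₂ : ∀ Λ ∈ 𝓛₂, (∀ x ∈ periodHomology M₂,
      Λ (HeckeRing0.T M₂ 2 q₀ hq₀ • x - ((q₀ + 1 : ℕ) : ℂ) • x) = 0) → ∀ x ∈ periodHomology M₂, Λ x = 0)
    (hsupp₀ : ∀ Λ ∈ 𝓛₀, ∀ t : HeckeRing0.primeTo M₀ 2 (M₀ * ℓ₂), t ∉ 𝔫 →
      (∀ x ∈ periodHomology M₀, Λ ((t : HeckeRing0 M₀ 2) • x) = 0) → ∀ x ∈ periodHomology M₀, Λ x = 0)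
    (hsurj₀ : ∀ Λ₀' ∈ 𝓛₀, ∃ Λ₀ ∈ 𝓛₀, ∀ x ∈ periodHomology M₀,
      Λ₀ (HeckeRing0.T M₀ 2 q₀ hq₀ • x - ((q₀ + 1 : ℕ) : ℂ) • x) = Λ₀' x)
    -- THE TWO PER-ROW INPUTS: the FREE decomposition ON CYCLES …
    {Λ₁ : Module.Dual ℂ (CuspForm (Gamma0 (M₀ * ℓ₂)) 2) → ZMod (p ^ e)} (hΛ₁ : Λ₁ ∈ 𝓛₁)
    {Λ₂ : Module.Dual ℂ (CuspForm (Gamma0 M₂) 2) → ZMod (p ^ e)} (hΛ₂ : Λ₂ ∈ 𝓛₂)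
    (hfree : ∀ r : ℚ, σN r ∈ periodHomology N → ratModP (p ^ e) (ratPlusSymbol f r) =
      (Λ₁ ((degeneracyMap0 (M₀ * ℓ₂) N 1 2).dualMap (σN r)) -
        Λ₁ ((degeneracyMap0 (M₀ * ℓ₂) N ℓ₁ 2).dualMap (σN r))) +
      (Λ₂ ((degeneracyMap0 M₂ N 1 2).dualMap (σN r)) - Λ₂ ((degeneracyMap0 M₂ N ℓ₂ 2).dualMap (σN r))))
    -- scalar stability of `𝓛₀`
    (hsmul₀ : ∀ Λ ∈ 𝓛₀, ∀ c : ZMod (p ^ e), (fun x ↦ c * Λ x) ∈ 𝓛₀)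
    -- two-copy injectivity at `ℓ₁` (`M₀ → M₂`; Ihara at `ℓ₁`, dual form, first slot)
    (hinjC₂ : ∀ Z ∈ 𝓛₀, ∀ Z' ∈ 𝓛₀,
      (∀ x ∈ periodHomology M₂,
        Z ((degeneracyMap0 M₀ M₂ 1 2).dualMap x) + Z' ((degeneracyMap0 M₀ M₂ ℓ₁ 2).dualMap x) = 0) →
      ∀ u ∈ periodHomology M₀, Z u = 0)
    -- … and FULL CYCLE-LEVEL EXACTNESS (Calegari–Venkatesh complex, row `E¹_{•,1}`)
    (hfullC : ∀ Λ ∈ 𝓛₁, ∀ Λ' ∈ 𝓛₁, ∀ Κ ∈ 𝓛₂, ∀ Κ' ∈ 𝓛₂,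
      (∀ y ∈ periodHomology N,
        Λ ((degeneracyMap0 (M₀ * ℓ₂) N 1 2).dualMap y) + Λ' ((degeneracyMap0 (M₀ * ℓ₂) N ℓ₁ 2).dualMap y) +
        (Κ ((degeneracyMap0 M₂ N 1 2).dualMap y) + Κ' ((degeneracyMap0 M₂ N ℓ₂ 2).dualMap y)) = 0) →
      ∃ Z₁ ∈ 𝓛₀, ∃ Z₂ ∈ 𝓛₀, ∃ Z₃ ∈ 𝓛₀, ∃ Z₄ ∈ 𝓛₀,
        (∀ x ∈ periodHomology (M₀ * ℓ₂), Λ x =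
          Z₁ ((degeneracyMap0 M₀ (M₀ * ℓ₂) 1 2).dualMap x) + Z₂ ((degeneracyMap0 M₀ (M₀ * ℓ₂) ℓ₂ 2).dualMap x)) ∧
        (∀ x ∈ periodHomology (M₀ * ℓ₂), Λ' x =
          Z₃ ((degeneracyMap0 M₀ (M₀ * ℓ₂) 1 2).dualMap x) + Z₄ ((degeneracyMap0 M₀ (M₀ * ℓ₂) ℓ₂ 2).dualMap x)) ∧
        (∀ x ∈ periodHomology M₂, Κ x =
          -(Z₁ ((degeneracyMap0 M₀ M₂ 1 2).dualMap x) + Z₃ ((degeneracyMap0 M₀ M₂ ℓ₁ 2).dualMap x))) ∧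
        (∀ x ∈ periodHomology M₂, Κ' x =
          -(Z₂ ((degeneracyMap0 M₀ M₂ 1 2).dualMap x) + Z₄ ((degeneracyMap0 M₀ M₂ ℓ₁ 2).dualMap x)))) :
    PlusSymbolLevelLowersAdditivelyModAt W p f (p ^ e) ℓ₁ ℓ₂ := by
  have hℓ₂ : Fact ℓ₂.Prime := inferInstance
  haveI : NeZero ℓ₂ := ⟨hℓ₂.out.ne_zero⟩
  have hM1N : M₀ * ℓ₂ ∣ N := by simpa using h1N
  have hq₀1M1 : q₀ ≡ 1 [MOD M₀ * ℓ₂] := hq₀1.of_dvd hM1N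
  -- closure properties in the shape of K101
  have hs₁ : ∀ Λ ∈ 𝓛₁, (fun x ↦ -((1 : ZMod (p ^ e)) * Λ x)) ∈ 𝓛₁ := fun Λ hΛ ↦ by
    have h := hsmul₁ Λ hΛ (-1)
    have e1 : (fun x ↦ -((1 : ZMod (p ^ e)) * Λ x)) = fun x ↦ (-1) * Λ x := by funext x; ring
    rw [e1]; exact h
  have hs₂ : ∀ Λ ∈ 𝓛₂, (fun x ↦ -((1 : ZMod (p ^ e)) * Λ x)) ∈ 𝓛₂ := fun Λ hΛ ↦ by
    have h := hsmul₂ Λ hΛ (-1)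
    have e1 : (fun x ↦ -((1 : ZMod (p ^ e)) * Λ x)) = fun x ↦ (-1) * Λ x := by funext x; ring
    rw [e1]; exact h
  have hlin₀ : ∀ Z ∈ 𝓛₀, ∀ Z' ∈ 𝓛₀, ∀ w : ZMod (p ^ e), (fun x ↦ Z x + w * Z' x) ∈ 𝓛₀ :=
    fun Z hZ Z' hZ' w ↦ by
    have h := hsub₀ Z hZ _ (hsmul₀ Z' hZ' (-w))
    have e1 : (fun x ↦ Z x + w * Z' x) = fun x ↦ Z x - (fun x ↦ (-w) * Z' x) x := by funext x; ring
    rw [e1]; exact h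
  -- `Λ 0 = 0` on `𝓛₀`
  have h0 : ∀ Z ∈ 𝓛₀, Z 0 = 0 := fun Z hZ ↦ by
    have h := hadd₀ Z hZ 0 (periodHomology M₀).zero_mem 0 (periodHomology M₀).zero_mem
    rw [add_zero] at h
    linear_combination -h
  -- the two-copy injectivity at `ℓ₂` from Ihara BY NAME
  have hinjC₁ : ∀ Z ∈ 𝓛₀, ∀ Z' ∈ 𝓛₀,
      (∀ x ∈ periodHomology (M₀ * ℓ₂),
        Z ((degeneracyMap0 M₀ (M₀ * ℓ₂) 1 2).dualMap x) + Z' ((degeneracyMap0 M₀ (M₀ * ℓ₂) ℓ₂ 2).dualMap x) = 0) →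
      (∀ u ∈ periodHomology M₀, Z u = 0) ∧ (∀ u ∈ periodHomology M₀, Z' u = 0) :=
    fun Z hZ Z' hZ' hv ↦ twoCopy_apply_eq_zero_of_ribet1984_iharaLemma hI hℓ₂M₀ 𝔫 h𝔫 h2𝔫
      (fun hE ↦ hq₀E (hE q₀ hq₀ hq₀S hq₀1M1)) Z Z' (h0 Z hZ) (h0 Z' hZ') (hsupp₀ Z hZ) (hsupp₀ Z' hZ') hv
  -- signed cycle-exactness from the full one (K101), then K97
  have hexactC := signedExactCycles_of_fullExactCycles (dvd_refl (M₀ * ℓ₂)) h02' (1 : ZMod (p ^ e)) 1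
    𝓛₁ 𝓛₂ 𝓛₀ hs₁ hs₂ hlin₀ hfullC hinjC₁ hinjC₂
  exact plusSymbolLevelLowersAdditivelyModAt_of_cycles_of_ribet1984_iharaLemma hI hp2 hirr hf hN hℓ₁N hℓ₂N
    hℓ₂M₀ h02 h02' h1N h1N' h2N h2N' σ0 hσ0 σ1 hσ1 σ2 hσ2 σN hσN hq₀ hq₀1 hq₀N hu 𝔫 h𝔫 h2𝔫 hq₀S hq₀E
    𝓛₁ 𝓛₂ 𝓛₀ hadd₁ hadd₂ hadd₀ hT₁ hT₂ hT₀ hA₁ hA₂ hsub₁ hsub₂ hsub₀ hsmul₁ hsmul₂ hpull₁ hpull₂ hsupp₁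
    hsupp₂ hsupp₀ hsurj₀ hΛ₁ hΛ₂ hfree hexactC

end OfFullCycles

end Summit.BirchSwinnertonDyer.Rank1Residual.LevelLowering

end
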